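import Summits.BirchSwinnertonDyer.Rank1Residual.X5.TwoAdicLocalIndex
import Summits.BirchSwinnertonDyer.Rank1Residual.X5.TwoAdicLogLatticeLemmas
import Literature.NumberTheory.EllipticCurves.PadicFiltrationIndexProofs
import Literature.NumberTheory.EllipticCurves.TamagawaNeZeroProofs
import Literature.NumberTheory.EllipticCurves.ComplexMultiplicationCoatesWilesReductionIndexProofs
import HarnessLib

/-!
# Class O1 (X5, `p = 2`): LEMMA ι PROVED — `v₂(log_ω E(ℚ₂)) = 1 + t₂ − v₂(c₂) − v₂(#Ẽ_ns(𝔽₂))`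
# (`O1.LocalLogDivIndexAtTwo W` holds for every globally minimal elliptic `W/ℚ`)

HONEST FRAMING (cell `b2b-bsdres`, run/shared/lean/b2b/bsd-rank1-residual/, verbatim in every
file): the goal of the cell is to DELETE the COMBINATION-SHAPED residual classes of the
Birch–Swinnerton-Dyer formula for ALL analytic-rank `≤ 1` elliptic curves over `ℚ` — "full BSD
formula for every rank `≤ 1` curve in class `C`" assembled STRICTLY from published theorems — so
that the rank-`≤ 1` remainder becomes exactly the CONSTRUCTION-SHAPED classes, which are TYPED
(missing-input `Prop`s), NOT attempted. This is not "finishing BSD". THEOREMS ONLY (nothing about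
any particular curve is asserted beyond what is proved; nothing booked; no mark of RESIDUAL-MAP §I
moves).

Unit `b2b-bsdres-cc-typer-4` (lane CLASS-CLOSURE, class O1), gen 5: the typed slot (17′)
`O1.LocalLogDivIndexAtTwo` of `X5/TwoAdicLocalIndex.lean` §3 (LEMMA ι of lens-3 (D4)/(ι-E), lead D23,
register name `localIndexAtTwo_eq`; re-typed with the logarithm extended by division) is DISCHARGED:

* `localLogDivIndexAtTwo_holds : LocalLogDivIndexAtTwo W` for every `W/ℚ` elliptic and globally
  minimal — with `log = padicLogDiv W₂` (`W₂ = W ⊗ ℚ₂`, `ℤ₂`-minimal) and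
  `e(W) = 1 + t₂ − v₂(c₂) − v₂(#Ẽ_ns(𝔽₂))` (`localLogIndexExponentAtTwo`), every `P ∈ E(ℚ₂)` has
  `‖log P‖₂ ≤ 2^{−e(W)}` and some `P` attains it, i.e. `log_ω(E(ℚ₂)) = 2^{e(W)}ℤ₂`.

Proof (Silverman, *AEC* IV.6.4 (b), VII.2.1–2.2, VII.6; six lines in lead D23 §2, all inputs in the
tree): `log : E(ℚ₂) → ℚ₂` is a homomorphism (`padicLogDiv_add`) with kernel the torsion
(`padicLogDiv_eq_zero_iff`) meeting `E⁽²⁾(ℚ₂)` trivially, and on `E⁽²⁾(ℚ₂)` it is the limit logarithm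
`L : E⁽²⁾(ℚ₂) → 4ℤ₂`, onto with `‖L P‖ = ‖z(P)‖` (`exists_mem_padicLimitLog_eq`,
`norm_padicLimitLog_of_mem`); the index `[E(ℚ₂) : E⁽²⁾(ℚ₂)] = c₂·#Ẽ_ns(𝔽₂)·2`
(`WeierstrassCurve.index_formalFiltration`, finite by `localTamagawaNumber_padic_ne_zero_holds` and
`reductionPointCount_pos`); hence `#E(ℚ₂)_tors · [log E(ℚ₂) : 4ℤ₂] = 2c₂#Ẽ_ns(𝔽₂)`
(`card_ker_mul_relIndex_map_eq_index`), the lattice `log E(ℚ₂) ⊇ 4ℤ₂` is the ball `2^{2−k}ℤ₂`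
with `2^k = [log E(ℚ₂) : 4ℤ₂]` (`exists_relIndex_eq_pow_of_ball_le`), and
`v₂(#E(ℚ₂)_tors) = t₂` (`padicValNat_card_torsion_eq_primaryComponent`); `#Ẽ_ns(𝔽₂)` of the
`ℤ₂`-model is `reductionPointCount W 2` (`natCard_point_padicModel_residue`).

References: J. H. Silverman, *The Arithmetic of Elliptic Curves*, 2nd ed. (2009), IV.3.2 (a),
IV.6.4 (b), VII.2.1–2.2, VII.6.1–6.3 [SilvermanAEC2009]; K. Kato, Astérisque 295 (2004),
Prop. 14.16–14.18 (where the index enters) [Kato2004Asterisque].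
-/

set_option autoImplicit false

noncomputable section

open scoped Classical

open WeierstrassCurve Literature.NumberTheory.EllipticCurves

namespace Summit.BirchSwinnertonDyer.Rank1Residual.X5.O1

variable (W : WeierstrassCurve ℚ) [W.IsElliptic] [W.IsGloballyMinimal]

omit [W.IsElliptic] in
/-- `#Ẽ_ns(𝔽₂)` of Mathlib's reduction of the `ℤ₂`-minimal `W ⊗ ℚ₂` is the tree's
`reductionPointCount W 2` (both are the point count of `integralModelInt W` read modulo `2`;
`ℤ₂/2ℤ₂ ≃ ℤ/2`). [cite: SilvermanAEC2009, VII.2 (reduction of a minimal equation)] -/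
theorem natCard_point_reduction_map_two [(W.map (algebraMap ℚ ℚ_[2])).IsMinimal ℤ_[2]] :
    Nat.card ((W.map (algebraMap ℚ ℚ_[2])).reduction ℤ_[2]).toAffine.Point =
      reductionPointCount W 2 := by
  have key : ∀ (X : WeierstrassCurve ℚ_[2]) [X.IsMinimal ℤ_[2]],
      X = ((integralModelInt W).map (Int.castRingHom ℤ_[2])).baseChange ℚ_[2] →
      Nat.card (X.reduction ℤ_[2]).toAffine.Point = reductionPointCount W 2 := by
    intro X _ hX
    subst hX
    rw [reduction_baseChange_eq ℤ_[2]]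
    exact W.natCard_point_padicModel_residue 2
  exact key _ (by rw [W.padicModel_baseChange 2]; rfl)

/-- **LEMMA ι (ι-E) PROVED**: `O1.LocalLogDivIndexAtTwo W` — for the globally minimal elliptic
`W/ℚ`, with `log` the `2`-adic Néron logarithm extended by division on `E(ℚ₂)` and
`e(W) = 1 + t₂ − v₂(c₂) − v₂(#Ẽ_ns(𝔽₂))`: `‖log P‖₂ ≤ 2^{−e(W)}` for all `P ∈ E(ℚ₂)`, with equality
for some `P` (i.e. `v₂(𝔩₂(E)) = e(W)`).
[cite: SilvermanAEC2009, IV.6.4 (b), VII.2.1–2.2, VII.6.1–6.3]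
[cite: Kato2004Asterisque, Prop. 14.16–14.18] -/
theorem localLogDivIndexAtTwo_holds : LocalLogDivIndexAtTwo W := by
  haveI hmin := isMinimal_map_padic_of_isGloballyMinimal W 2
  -- the hom `log : E(ℚ₂) →+ ℚ₂`
  set H : AddSubgroup (W.map (algebraMap ℚ ℚ_[2])).toAffine.Point :=
    (W.map (algebraMap ℚ ℚ_[2])).formalFiltration 2 with hH
  set f : (W.map (algebraMap ℚ ℚ_[2])).toAffine.Point →+ ℚ_[2] :=
    AddMonoidHom.mk' (padicLogDiv (W.map (algebraMap ℚ ℚ_[2])))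
      (padicLogDiv_add (W.map (algebraMap ℚ ℚ_[2]))) with hf
  have hfapply : ∀ P, f P = padicLogDiv (W.map (algebraMap ℚ ℚ_[2])) P := fun P => rfl
  -- the index `m = c₂ · #Ẽ_ns(𝔽₂) · 2 ≠ 0`
  have hidx : H.index = (W.map (algebraMap ℚ ℚ_[2])).localTamagawaNumber ℤ_[2] *
      reductionPointCount W 2 * 2 := by
    rw [hH, (W.map (algebraMap ℚ ℚ_[2])).index_formalFiltration (n := 2) (by norm_num),
      natCard_point_reduction_map_two W]
    norm_num
  have hc0 : (W.map (algebraMap ℚ ℚ_[2])).localTamagawaNumber ℤ_[2] ≠ 0 :=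
    localTamagawaNumber_padic_ne_zero_holds 2 (W.map (algebraMap ℚ ℚ_[2]))
  have hN0 : reductionPointCount W 2 ≠ 0 := (reductionPointCount_pos W 2).ne'
  have hm0 : H.index ≠ 0 := by
    rw [hidx]; exact mul_ne_zero (mul_ne_zero hc0 hN0) two_ne_zero
  -- kernel = torsion, meeting `H` trivially
  have hker : f.ker = AddCommGroup.torsion (W.map (algebraMap ℚ ℚ_[2])).toAffine.Point := by
    ext P
    rw [AddMonoidHom.mem_ker, hfapply, padicLogDiv_eq_zero_iff _ hm0, AddCommGroup.mem_torsion]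
  have hinf : H ⊓ f.ker = ⊥ := by
    rw [eq_bot_iff]
    intro P hP
    rw [AddSubgroup.mem_inf, AddMonoidHom.mem_ker, hfapply, padicLogDiv_of_mem _ hm0 hP.1] at hP
    rw [AddSubgroup.mem_bot]
    exact (W.map (algebraMap ℚ ℚ_[2])).eq_zero_of_padicLimitLog_eq_zero le_rfl hP.1 hP.2
  -- `log(E⁽²⁾) = 4ℤ₂`
  have h4 : (((2 : ℕ) : ℝ)⁻¹) ^ 2 = (2 : ℝ) ^ (-(2 : ℤ)) := by norm_num
  have hball : ∀ t : ℚ_[2], t ∈ H.map f ↔ ‖t‖ ≤ ((2 : ℕ) : ℝ) ^ (-((2 : ℕ) : ℤ)) := by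
    intro t
    rw [Nat.cast_ofNat, Nat.cast_ofNat]
    constructor
    · rintro ⟨P, hP, rfl⟩
      rw [hfapply, padicLogDiv_of_mem _ hm0 hP,
        (W.map (algebraMap ℚ ℚ_[2])).norm_padicLimitLog_of_mem le_rfl hP, ← h4]
      exact hP.2
    · intro ht
      rw [← h4] at ht
      obtain ⟨Q, hQ, hQt⟩ := (W.map (algebraMap ℚ ℚ_[2])).exists_mem_padicLimitLog_eq le_rfl ht
      exact ⟨Q, hQ, by rw [hfapply, padicLogDiv_of_mem _ hm0 hQ, hQt]⟩
  -- `#T · [log E : 4ℤ₂] = m`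
  have hTd : Nat.card f.ker * (H.map f).relIndex f.range = H.index :=
    card_ker_mul_relIndex_map_eq_index f H hinf
  have hd0 : (H.map f).relIndex f.range ≠ 0 := fun h => hm0 (by rw [← hTd, h, mul_zero])
  have hT0 : Nat.card f.ker ≠ 0 := fun h => hm0 (by rw [← hTd, h, zero_mul])
  -- the lattice `log E(ℚ₂)` is a ball: `[log E : 4ℤ₂] = 2^k`, sup of norms `2^k · 2^{-2}` attained
  obtain ⟨k, hdk, hle, s, hs, hseq⟩ :=
    exists_relIndex_eq_pow_of_ball_le (p := 2) (n := 2) hball (AddSubgroup.map_le_range f H) hd0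
  -- torsion: `#T ≠ 0`, `v₂(#T) = t₂`
  haveI : Finite f.ker := Nat.finite_of_card_ne_zero hT0
  haveI : Finite (AddCommGroup.torsion (W.map (algebraMap ℚ ℚ_[2])).toAffine.Point) := by
    rw [← hker]; infer_instance
  have hv := padicValNat_card_torsion_eq_primaryComponent
    (G := (W.map (algebraMap ℚ ℚ_[2])).toAffine.Point) 2
  have hcardT : Nat.card f.ker =
      Nat.card (AddCommGroup.torsion (W.map (algebraMap ℚ ℚ_[2])).toAffine.Point) := by
    rw [hker]
  -- valuations: `v₂(#T) + k = v₂(c₂) + v₂(#Ẽ_ns) + 1`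
  have hmain : Nat.card (AddCommGroup.torsion (W.map (algebraMap ℚ ℚ_[2])).toAffine.Point) * 2 ^ k =
      (W.map (algebraMap ℚ ℚ_[2])).localTamagawaNumber ℤ_[2] * reductionPointCount W 2 * 2 := by
    rw [← hcardT, ← hdk, hTd, hidx]
  have hT0' : Nat.card (AddCommGroup.torsion (W.map (algebraMap ℚ ℚ_[2])).toAffine.Point) ≠ 0 := by
    rw [← hcardT]; exact hT0
  have hval : padicValNat 2 (Nat.card
        (AddCommGroup.torsion (W.map (algebraMap ℚ ℚ_[2])).toAffine.Point)) + k =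
      padicValNat 2 ((W.map (algebraMap ℚ ℚ_[2])).localTamagawaNumber ℤ_[2]) +
        padicValNat 2 (reductionPointCount W 2) + 1 := by
    have h := congrArg (padicValNat 2) hmain
    rwa [padicValNat.mul hT0' (pow_ne_zero _ two_ne_zero), padicValNat.prime_pow,
      padicValNat.mul (mul_ne_zero hc0 hN0) two_ne_zero, padicValNat.mul hc0 hN0,
      padicValNat_self] at h
  have he : -localLogIndexExponentAtTwo W = (k : ℤ) - 2 := by
    rw [localLogIndexExponentAtTwo, ← hv]
    omega
  have hpow : (2 : ℝ) ^ (-localLogIndexExponentAtTwo W) = (2 : ℝ) ^ k * (2 : ℝ) ^ (-(2 : ℤ)) := by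
    rw [he, sub_eq_add_neg, zpow_add₀ (two_ne_zero), zpow_natCast]
  have hle' : ∀ P, ‖padicLogDiv (W.map (algebraMap ℚ ℚ_[2])) P‖ ≤
      (2 : ℝ) ^ (-localLogIndexExponentAtTwo W) := by
    intro P
    rw [hpow, ← hfapply]
    have h := hle (f P) ⟨P, rfl⟩
    rw [Nat.cast_ofNat, Nat.cast_ofNat] at h
    exact h
  obtain ⟨P, hP⟩ := hs
  have hseq' : ‖padicLogDiv (W.map (algebraMap ℚ ℚ_[2])) P‖ =
      (2 : ℝ) ^ (-localLogIndexExponentAtTwo W) := by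
    rw [hpow, ← hfapply, hP]
    rw [Nat.cast_ofNat, Nat.cast_ofNat] at hseq
    exact hseq
  exact ⟨hle', P, hseq'⟩

end Summit.BirchSwinnertonDyer.Rank1Residual.X5.O1

end
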